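import Literature.MathematicalPhysics.QuantumFieldTheory.Balaban1983to89.B4Prop23RegularRegion

/-!
# `Balaban1983to89.B4Ineq120RegularAmbient` — T. Bałaban, *Regularity and decay of lattice Green's functions*, Commun.
# Math. Phys. **89** (1983) 571–597 [Balaban1983RegularityDecay] (= B4), «Proposition 2.3 of [1]» p. 574, clause
# (1.19)–(1.20), PART 1: the ambient propagator `C^{(k)}_Λ(Ω₀,A)` seen from `Ω ⊂ Ω₀` at a regular `A ≠ 0` — its form
# matrix `H₀` on `Ω`'s carriers, the entry identities, and (5.3) for it

statement-level skeleton of published theorems with citation tags; proofs where landed; nothing here is a claim about the Yang–Mills mass gap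

PDF held: `paper:balaban1983-cmp89-regularity-decay` (journal page = PDF page + 570); pp. 572–574, 593–594 [PDF 2–4,
23–24] read on the ×2 renders `…/b2b-balaban-ref1/pages/1983-cmp89-regularity-decay/…-p0NN-x2.png`.

CITATION HEADER (lean-in-tree rule).  Cell `lit-balaban` (HOME `run/shared/lean/pub/lit-balaban/`), Phase-2 proof seat
**p17** gen 3 (unit `lit-balaban-p17-g3`), file 4a of the MODEL INSTANCE of SKELETON row **B4.Prop2.3[I]**
(`B4.Prop23Printed`, owner r01, referee ref-4) AT A REGULAR `A ≠ 0`.  r01's §5 route `B4Prop23Sect5Route.prop23_120_of_cor23`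
((1.20) from (5.3), (5.4), (5.5) and the Sect. 5 Theorem (5.9)–(5.10)) is stated for TWO form matrices `H`, `H₀` on the SAME
fine carrier `X` of `Ω`; this file supplies `H₀` for `C^{(k)}_Λ(Ω₀,A)`, `Λ ⊆ Ω^{(k)} ⊆ Ω₀^{(k)}`, from b04's region operator
(1.6) of `Ω₀` (`B4Lemma21Region.regionOp`, its positivity (1.8) `regionOp_form_ge`), b04's nested-region algebra
`B4Cor23RegionDeltaAlg.{extV, resV, sum_eq_sum_incl, contourTrans_incl, rBlkWt_incl, green_transpose}`, gen 2's dictionary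
`B4Cor23Rep36Bridge.{hamR, QkR, kForm_eq_regionOp, gk_eq_green}` and p17's `B4NextAvg52.nextAvg` (`Q(A)`, (5.2)).

WHAT IS PRINTED (p. 574 [PDF 4], verbatim): *"Finally, for Ω ⊂ Ω₀ and δC^{(k)}_Λ(Ω,Ω₀,A) = C^{(k)}_Λ(Ω,A) −
C^{(k)}_Λ(Ω₀,A), (1.19) we have |δC^{(k)}_Λ(Ω,Ω₀,A; x,x′)| ≤ c₀exp(−δ₀(|x−x′| + dist(x,Ω^{(k)c}) + dist(x′,Ω^{(k)c}))),
x, x′ ∈ Λ. (1.20)"*, with (p. 573) *"C^{(k)}_Λ(Ω,A) = ((Δ^{(k)}(Ω,A) + aL^{−2}P(A))|_Λ)^{−1} (1.13) … Δ^{(k)}(Ω,A) = a_kI −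
a_k²Q_k(A)G_k(Ω,A)Q_k^*(A) (1.14)"*.

DICTIONARY (as files 1–3 of this seat; lattice units, `d ↦ d+1`).  NESTED LABEL SETS `Zc ⊆ Z₀c` (`Ω^{(k+1)} ⊆ Ω₀^{(k+1)}`),
`Ω^{(k)} = fineDom L Zc ⊆ Ω₀^{(k)} = fineDom L Z₀c`, fine points `X ⊆ X₀` (`fine_sub`), everything `× {colours}` (`inclι`).
`C^{(k)}_Λ(Ω₀,A)` for `Λ ⊆ Ω^{(k)}`: the rows `y ∈ Ω^{(k)}` of `Q_k(A)` of `Ω₀` live in `B^k(y) ⊂ Ω` and agree with those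
of `Ω` (`QkR_incl`, `QkR_incl_out`), and `P(A)` is block-diagonal with the same blocks (`nextAvg_incl`, `pOp_incl`); hence
`[Δ^{(k)}(Ω₀,A)]_{Ω^{(k)}Ω^{(k)}} = a_kI − a_k²Q_k[G_k(Ω₀,A)]_{ΩΩ}Q_kᵀ` only sees the COMPRESSION `[G_k(Ω₀,A)]_{ΩΩ}` (`gM0`)
of `(regionOp … Ω₀ …)⁻¹` to `X`, which is r01's `gk H₀ a_k Q_k` for **`H₀ = ([G_k(Ω₀,A)]_{ΩΩ})^{−1} − a_kQ_kᵀQ_k`** (`ham0`,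
`gk_ham0`; `[G_k(Ω₀,A)]_{ΩΩ} > 0` by (1.8) for `Ω₀`, Mathlib `PosDef.inv/.submatrix/.isUnit`) — `deltaK_incl`.

WHAT IS KERNEL-CHECKED (zero `sorry`, standard axioms; no `Prop`-valued definition): §1 extension by zero on site–colour
pairs (`inclι`, `sum_eq_sum_inclι`, `resV_mulVec_extV`, `dot_extV_mulVec_extV`); §2 `gM0`, `ham0`, `kForm_ham0`, `gM0_posDef`,
**`gk_ham0`**, `ham0_isSymm`; §3 the entry identities `QkR_incl(_out)`, `nextAvg_incl(_out)`, `pOp_incl`, **`deltaK_incl`**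
(`Δ^{(k)}(Ω₀,A)` restricted to `Ω^{(k)}` IS `deltaK H₀ a_k Q_k`) and **`form115_lower_ambient`**: a lower bound (5.3) for
`Δ^{(k)}(Ω₀,A) + a′L^{−2}P(A)` on `Ω₀^{(k)}` descends to the restriction (r01's `hlow₀`).  HONEST SCOPE: finite nested block
unions; (1.7) on `Ω₀` and b04's smallness of `e` wherever `G_k(Ω₀,A) > 0` is used.  The bound (1.20) itself is PART 2,
`B4Ineq120RegularRegion`.  Unit `lit-balaban-p17-g3`, HOME as above.
-/

namespace Literature.MathematicalPhysics.QuantumFieldTheory.Balaban1983to89.B4Ineq120RegularAmbient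

open Finset Matrix
open Literature.MathematicalPhysics.QuantumFieldTheory.Balaban1983to89
open Literature.MathematicalPhysics.QuantumFieldTheory.Balaban1983to89.B4GaugeCovariance (OrthFlow avgOp)
open Literature.MathematicalPhysics.QuantumFieldTheory.Balaban1983to89.B4Lower18Regular (e1 dotProduct_self_nonneg')
open Literature.MathematicalPhysics.QuantumFieldTheory.Balaban1983to89.B4Reflection242 (blk)
open Literature.MathematicalPhysics.QuantumFieldTheory.Balaban1983to89.B4Lower18 (fineDom mem_fineDom)
open Literature.MathematicalPhysics.QuantumFieldTheory.Balaban1983to89.B4TwoRegion120 (incl incl_injective fineDom_mono)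
open Literature.MathematicalPhysics.QuantumFieldTheory.Balaban1983to89.B4Lemma21Region (regionOp regionOp_form_ge)
open Literature.MathematicalPhysics.QuantumFieldTheory.Balaban1983to89.B4Cor23RegionDeltaAlg (extV resV extV_incl
  extV_of_not_mem extV_dotProduct extV_dotProduct_extV sum_eq_sum_incl contourTrans_incl rBlkWt_incl trn
  regionOp_transpose green_transpose)
open Literature.MathematicalPhysics.QuantumFieldTheory.Balaban1983to89.B4GaussRep36 (kForm gk pOp)
open Literature.MathematicalPhysics.QuantumFieldTheory.Balaban1983to89.B4Cor23Rep36Bridge (hamR qkR QkR blkR qkR_off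
  kForm_eq_regionOp gk_eq_green)
open Literature.MathematicalPhysics.QuantumFieldTheory.Balaban1983to89.B4Prop31Charts (linkR transR)
open Literature.MathematicalPhysics.QuantumFieldTheory.Balaban1983to89.B4NextAvg52 (uField qL nextAvg qL_off)

noncomputable section

variable {d : ℕ} {ι : Type} [Fintype ι] [DecidableEq ι]

/-! ## §1. Extension by zero on site–colour pairs along nested site sets -/

section Ext

variable {R R₀ : Finset (Fin (d + 1) → ℤ)} (h : R ⊆ R₀)

/-- the inclusion `R × {colours} ↪ R₀ × {colours}`. [cite: Balaban1983RegularityDecay, (1.11) p.573, dictionary] -/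
def inclι (h : R ⊆ R₀) (p : ↥R × ι) : ↥R₀ × ι := (incl h p.1, p.2)

omit [Fintype ι] [DecidableEq ι] in
/-- the inclusion is injective. [cite: Balaban1983RegularityDecay, (1.11) p.573, dictionary] -/
theorem inclι_injective : Function.Injective (inclι (ι := ι) h) := fun p q hpq => by
  simp only [inclι, Prod.mk.injEq] at hpq
  exact Prod.ext (incl_injective h hpq.1) hpq.2

omit [DecidableEq ι] in
/-- a sum over `R₀ × {colours}` of a quantity vanishing off `R` is a sum over `R × {colours}`.
[cite: Balaban1983RegularityDecay, (1.11) p.573, dictionary] -/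
theorem sum_eq_sum_inclι {M : Type*} [AddCommMonoid M] (Φ : ↥R₀ × ι → M)
    (hΦ : ∀ P : ↥R₀ × ι, P.1.1 ∉ R → Φ P = 0) : ∑ P, Φ P = ∑ p : ↥R × ι, Φ (inclι h p) := by
  rw [Fintype.sum_prod_type, Fintype.sum_prod_type,
    sum_eq_sum_incl h (fun z => ∑ i, Φ (z, i)) fun z hz => Finset.sum_eq_zero fun i _ => hΦ (z, i) hz]
  rfl

omit [DecidableEq ι] in
/-- `(K₀·ext v)|_R = K′v` when the entries of `K₀` on `R × R` are those of `K′`. [cite: Balaban1983RegularityDecay, (1.11) p.573, dictionary] -/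
theorem resV_mulVec_extV (K₀ : Matrix (↥R₀ × ι) (↥R₀ × ι) ℝ) (K' : Matrix (↥R × ι) (↥R × ι) ℝ)
    (hK : ∀ p q, K₀ (inclι h p) (inclι h q) = K' p q) (v : ↥R × ι → ℝ) :
    resV h (K₀ *ᵥ extV R₀ v) = K' *ᵥ v := by
  funext p
  show (K₀ *ᵥ extV R₀ v) (inclι h p) = _
  simp only [Matrix.mulVec, dotProduct]
  rw [sum_eq_sum_inclι h _ fun P hP => by rw [extV_of_not_mem v P hP, mul_zero]]
  refine Finset.sum_congr rfl fun q _ => ?_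
  rw [hK, show extV R₀ v (inclι h q) = v q from by rw [show inclι h q = (incl h q.1, q.2) from rfl, extV_incl]]

omit [DecidableEq ι] in
/-- `⟨ext u, K₀ ext v⟩_{R₀} = ⟨u, K′v⟩_R` under the same entry identity. [cite: Balaban1983RegularityDecay, (1.11) p.573, dictionary] -/
theorem dot_extV_mulVec_extV (K₀ : Matrix (↥R₀ × ι) (↥R₀ × ι) ℝ) (K' : Matrix (↥R × ι) (↥R × ι) ℝ)
    (hK : ∀ p q, K₀ (inclι h p) (inclι h q) = K' p q) (u v : ↥R × ι → ℝ) :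
    extV R₀ u ⬝ᵥ (K₀ *ᵥ extV R₀ v) = u ⬝ᵥ (K' *ᵥ v) := by
  rw [extV_dotProduct h, resV_mulVec_extV h K₀ K' hK]

end Ext

/-! ## §2. `[G_k(Ω₀,A)]_{ΩΩ}` and the form matrix `H₀` of `C^{(k)}_Λ(Ω₀,A)` on `Ω`'s carriers -/

section Ambient

/-- `Ω ⊆ Ω₀` at the level of fine points. [cite: Balaban1983RegularityDecay, (1.11) p.573] -/
theorem fine_sub {n L : ℕ} (hn : 1 ≤ n) (hL : 1 ≤ L) {Zc Z₀c : Finset (Fin (d + 1) → ℤ)} (hsub : Zc ⊆ Z₀c) :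
    fineDom n (fineDom L Zc) ⊆ fineDom n (fineDom L Z₀c) :=
  fineDom_mono hn (fineDom_mono hL hsub)

variable (F : OrthFlow ι) (e : ℝ) {n L : ℕ} (hn : 1 ≤ n) (hL : 1 ≤ L) (a m2 : ℝ) {Zc Z₀c : Finset (Fin (d + 1) → ℤ)}
  (hsub : Zc ⊆ Z₀c) (Ac : (Fin (d + 1) → ℤ) → Fin (d + 1) → ℝ)

/-- **`[G_k(Ω₀,A)]_{ΩΩ}`**: the propagator (1.6) of `Ω₀` compressed to the fine points of `Ω` — the only part of
`G_k(Ω₀,A)` seen by `C^{(k)}_Λ(Ω₀,A)`, `Λ ⊆ Ω^{(k)}`. [cite: Balaban1983RegularityDecay, (1.6) p.572, (1.13)–(1.14) p.573, (1.19) p.574] -/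
def gM0 : Matrix (↥(fineDom n (fineDom L Zc)) × ι) (↥(fineDom n (fineDom L Zc)) × ι) ℝ :=
  ((regionOp F e hn a m2 (fineDom L Z₀c) Ac)⁻¹).submatrix (inclι (fine_sub hn hL hsub)) (inclι (fine_sub hn hL hsub))

/-- **`H₀ = ([G_k(Ω₀,A)]_{ΩΩ})^{−1} − a_kQ_k(A)ᵀQ_k(A)`**, the form matrix on `Ω`'s fine points whose r01-propagator
`gk H₀ a_k Q_k` is `[G_k(Ω₀,A)]_{ΩΩ}`. [cite: Balaban1983RegularityDecay, (1.14) p.573, (1.19) p.574, dictionary] -/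
def ham0 : Matrix (↥(fineDom n (fineDom L Zc)) × ι) (↥(fineDom n (fineDom L Zc)) × ι) ℝ :=
  (gM0 F e hn hL a m2 hsub Ac)⁻¹ - a • ((QkR F e hn (fineDom L Zc) Ac)ᵀ * QkR F e hn (fineDom L Zc) Ac)

/-- `H₀ + a_kQ_kᵀQ_k = ([G_k(Ω₀,A)]_{ΩΩ})^{−1}`. [cite: Balaban1983RegularityDecay, (1.6) p.572, dictionary] -/
theorem kForm_ham0 : kForm (ham0 F e hn hL a m2 hsub Ac) a (QkR F e hn (fineDom L Zc) Ac) = (gM0 F e hn hL a m2 hsub Ac)⁻¹ := by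
  unfold kForm ham0
  exact sub_add_cancel _ _

/-- `[G_k(Ω₀,A)]_{ΩΩ}` is symmetric. [cite: Balaban1983RegularityDecay, (1.6) p.572] -/
theorem gM0_transpose : (gM0 F e hn hL a m2 hsub Ac)ᵀ = gM0 F e hn hL a m2 hsub Ac := by
  unfold gM0
  rw [Matrix.transpose_submatrix, green_transpose]

/-- `H₀` is symmetric (r01's `hH₀`). [cite: Balaban1983RegularityDecay, (1.6) p.572, Sect. 5 Theorem p.594 «symmetric operator»] -/
theorem ham0_isSymm : (ham0 F e hn hL a m2 hsub Ac).IsSymm := by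
  unfold Matrix.IsSymm ham0
  rw [Matrix.transpose_sub, Matrix.transpose_nonsing_inv, gM0_transpose, Matrix.transpose_smul, Matrix.transpose_mul,
    Matrix.transpose_transpose]

/-- positive definiteness from a form bound. [folklore] -/
private theorem posDef_of_form_ge {m : Type*} [Fintype m] [DecidableEq m] {M : Matrix m m ℝ} (hM : M.IsSymm)
    {γ : ℝ} (hγ : 0 < γ) (h : ∀ v : m → ℝ, γ * (v ⬝ᵥ v) ≤ v ⬝ᵥ (M *ᵥ v)) : M.PosDef := by
  refine Matrix.PosDef.of_dotProduct_mulVec_pos (Matrix.isHermitian_iff_isSymm.2 hM) fun x hx => ?_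
  rw [star_trivial]
  have hxx : 0 < x ⬝ᵥ x := by
    rcases (dotProduct_self_nonneg' x).lt_or_eq with hlt | heq
    · exact hlt
    · exact absurd (dotProduct_self_eq_zero.1 heq.symm) hx
  exact lt_of_lt_of_le (mul_pos hγ hxx) (h x)

variable {F e a m2 Ac} {ℓ : ℝ} (hℓ : 0 ≤ ℓ)
  (hLip : ∀ t (v : ι → ℝ), ((F.U t - 1) *ᵥ v) ⬝ᵥ ((F.U t - 1) *ᵥ v) ≤ (ℓ * t) ^ 2 * (v ⬝ᵥ v))
  (he : 0 < e) (ha : 0 < a) (hm : 0 ≤ m2) {c β : ℝ} (hc : 0 ≤ c)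
  (h17 : ∀ x ∈ fineDom n (fineDom L Z₀c), ∀ μ ν : Fin (d + 1), |Ac (x + e1 μ) ν - Ac x ν| ≤ c * e ^ (β - 1) / n)
  (hsmall : ℓ ^ 2 * ((d + 1) * c * e ^ β) ^ 2 * (d + 1) * (1 + a * (d + 1)) ≤ min 2 a / 4)

include hℓ hLip he ha hm hc h17 hsmall in
/-- `[G_k(Ω₀,A)]_{ΩΩ} > 0` (b04's (1.8) for `Ω₀`, then inverse and compression). [cite: Balaban1983RegularityDecay, (1.8) p.573] -/
theorem gM0_posDef : (gM0 F e hn hL a m2 hsub Ac).PosDef := by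
  have hγ : 0 < min 2 a / 4 + m2 := add_pos_of_pos_of_nonneg (div_pos (lt_min two_pos ha) four_pos) hm
  have hR : (regionOp F e hn a m2 (fineDom L Z₀c) Ac).PosDef :=
    posDef_of_form_ge (regionOp_transpose F e hn a m2 Ac _) hγ
      (regionOp_form_ge F hℓ hLip he hn ha (fineDom L Z₀c) hc h17 hsmall)
  exact hR.inv.submatrix (inclι_injective _)

include hℓ hLip he ha hm hc h17 hsmall in
/-- **`gk H₀ a_k Q_k = [G_k(Ω₀,A)]_{ΩΩ}`** (r01's propagator of the form matrix `H₀`). [cite: Balaban1983RegularityDecay, (1.6) p.572, (1.19) p.574, dictionary] -/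
theorem gk_ham0 : gk (ham0 F e hn hL a m2 hsub Ac) a (QkR F e hn (fineDom L Zc) Ac) = gM0 F e hn hL a m2 hsub Ac := by
  unfold gk
  rw [kForm_ham0]
  exact Matrix.nonsing_inv_nonsing_inv _
    ((Matrix.isUnit_iff_isUnit_det _).mp (gM0_posDef hn hL hsub hℓ hLip he ha hm hc h17 hsmall).isUnit)

end Ambient

/-! ## §3. Entry identities: `Δ^{(k)}(Ω₀,A) + a′L^{−2}P(A)` of `Ω₀` restricted to `Ω^{(k)}`; (5.3) for it -/

section Entries

variable (F : OrthFlow ι) (e κ : ℝ) {n L : ℕ} (hn : 1 ≤ n) (hL : 1 ≤ L) (a m2 : ℝ) {Zc Z₀c : Finset (Fin (d + 1) → ℤ)}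
  (hsub : Zc ⊆ Z₀c) (Ac : (Fin (d + 1) → ℤ) → Fin (d + 1) → ℝ)

/-- the rows `y ∈ Ω^{(k)}` of `Q_k(A)` are the same for `Ω` and `Ω₀` (block weights and staircase transporters in
`B^k(y) ⊂ Ω`). [cite: Balaban1983RegularityDecay, (1.4) p.572] -/
theorem QkR_incl (p : ↥(fineDom L Zc) × ι) (r : ↥(fineDom n (fineDom L Zc)) × ι) :
    QkR F e hn (fineDom L Z₀c) Ac (inclι (fineDom_mono hL hsub) p) (inclι (fine_sub hn hL hsub) r)
      = QkR F e hn (fineDom L Zc) Ac p r := by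
  show qkR n (fineDom L Z₀c) (incl (fineDom_mono hL hsub) p.1) (incl (fine_sub hn hL hsub) r.1)
      * trn F e hn (fineDom L Z₀c) Ac (incl (fineDom_mono hL hsub) p.1) (incl (fine_sub hn hL hsub) r.1) p.2 r.2
    = qkR n (fineDom L Zc) p.1 r.1 * trn F e hn (fineDom L Zc) Ac p.1 r.1 p.2 r.2
  unfold qkR
  rw [rBlkWt_incl hn (fineDom_mono hL hsub) p.1 r.1, show trn F e hn (fineDom L Z₀c) Ac (incl (fineDom_mono hL hsub) p.1)
    (incl (fine_sub hn hL hsub) r.1) = trn F e hn (fineDom L Zc) Ac p.1 r.1 from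
      contourTrans_incl F (e / n) hn (fineDom_mono hL hsub) Ac p.1 r.1]

/-- … and they vanish at the fine points of `Ω₀∖Ω`. [cite: Balaban1983RegularityDecay, (1.4) p.572] -/
theorem QkR_incl_out (p : ↥(fineDom L Zc) × ι) (P : ↥(fineDom n (fineDom L Z₀c)) × ι)
    (hP : P.1.1 ∉ fineDom n (fineDom L Zc)) : QkR F e hn (fineDom L Z₀c) Ac (inclι (fineDom_mono hL hsub) p) P = 0 := by
  show qkR n (fineDom L Z₀c) (incl (fineDom_mono hL hsub) p.1) P.1
    * trn F e hn (fineDom L Z₀c) Ac (incl (fineDom_mono hL hsub) p.1) P.1 p.2 P.2 = 0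
  rw [qkR_off hn (fineDom L Z₀c) _ P.1 fun hb => hP ?_, zero_mul]
  rw [mem_fineDom hn, show blk n P.1.1 = p.1.1 from congrArg Subtype.val hb]
  exact p.1.2

/-- the rows `z ∈ Ω^{(k+1)}` of `Q(A)` are the same for `Ω` and `Ω₀`. [cite: Balaban1983RegularityDecay, (5.2) p.593] -/
theorem nextAvg_incl (ζ : ↥Zc × ι) (p : ↥(fineDom L Zc) × ι) :
    nextAvg F κ hL Z₀c n Ac (inclι hsub ζ) (inclι (fineDom_mono hL hsub) p) = nextAvg F κ hL Zc n Ac ζ p := by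
  show qL L Z₀c (incl hsub ζ.1) (incl (fineDom_mono hL hsub) p.1)
      * transR F κ hL Z₀c (uField n Ac) (incl hsub ζ.1) (incl (fineDom_mono hL hsub) p.1) ζ.2 p.2
    = qL L Zc ζ.1 p.1 * transR F κ hL Zc (uField n Ac) ζ.1 p.1 ζ.2 p.2
  unfold qL transR linkR
  rw [rBlkWt_incl hL hsub ζ.1 p.1, contourTrans_incl F κ hL hsub (uField n Ac) ζ.1 p.1]

/-- … and vanish off `Ω^{(k+1)}`. [cite: Balaban1983RegularityDecay, (5.2) p.593] -/
theorem nextAvg_incl_out (ζ₀ : ↥Z₀c × ι) (hζ : ζ₀.1.1 ∉ Zc) (p : ↥(fineDom L Zc) × ι) :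
    nextAvg F κ hL Z₀c n Ac ζ₀ (inclι (fineDom_mono hL hsub) p) = 0 := by
  show qL L Z₀c ζ₀.1 (incl (fineDom_mono hL hsub) p.1)
    * transR F κ hL Z₀c (uField n Ac) ζ₀.1 (incl (fineDom_mono hL hsub) p.1) ζ₀.2 p.2 = 0
  rw [qL_off hL Z₀c ζ₀.1 _ fun hb => hζ ?_, zero_mul]
  have hp := p.1.2
  rw [mem_fineDom hL] at hp
  rw [← show blk L p.1.1 = ζ₀.1.1 from congrArg Subtype.val hb]
  exact hp

/-- **`P(A)` OF `Ω₀` RESTRICTED TO `Ω^{(k)}` IS `P(A)` OF `Ω`** (block-diagonal). [cite: Balaban1983RegularityDecay, (1.13) p.573, (5.1)–(5.2) p.593] -/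
theorem pOp_incl (w : ℝ) (p q : ↥(fineDom L Zc) × ι) :
    pOp w (nextAvg F κ hL Z₀c n Ac) (inclι (fineDom_mono hL hsub) p) (inclι (fineDom_mono hL hsub) q)
      = pOp w (nextAvg F κ hL Zc n Ac) p q := by
  unfold pOp
  simp only [Matrix.smul_apply, smul_eq_mul, Matrix.mul_apply, Matrix.transpose_apply]
  congr 1
  rw [sum_eq_sum_inclι hsub _ fun P hP => by rw [nextAvg_incl_out F κ hL hsub Ac P hP p, zero_mul]]
  exact Finset.sum_congr rfl fun ζ _ => by rw [nextAvg_incl, nextAvg_incl]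

variable {F e a m2 Ac} {ℓ : ℝ} (hℓ : 0 ≤ ℓ)
  (hLip : ∀ t (v : ι → ℝ), ((F.U t - 1) *ᵥ v) ⬝ᵥ ((F.U t - 1) *ᵥ v) ≤ (ℓ * t) ^ 2 * (v ⬝ᵥ v))
  (he : 0 < e) (ha : 0 < a) (hm : 0 ≤ m2) {c β : ℝ} (hc : 0 ≤ c)
  (h17 : ∀ x ∈ fineDom n (fineDom L Z₀c), ∀ μ ν : Fin (d + 1), |Ac (x + e1 μ) ν - Ac x ν| ≤ c * e ^ (β - 1) / n)
  (hsmall : ℓ ^ 2 * ((d + 1) * c * e ^ β) ^ 2 * (d + 1) * (1 + a * (d + 1)) ≤ min 2 a / 4)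

include hℓ hLip he ha hm hc h17 hsmall in
/-- **`Δ^{(k)}(Ω₀,A)` RESTRICTED TO `Ω^{(k)}` IS `a_kI − a_k²Q_k[G_k(Ω₀,A)]_{ΩΩ}Q_kᵀ`** = r01's `deltaK H₀ a_k Q_k`.
[cite: Balaban1983RegularityDecay, (1.14) p.573, (1.19) p.574] -/
theorem deltaK_incl (p q : ↥(fineDom L Zc) × ι) :
    B4GaussRep36.deltaK (hamR F e m2 (fineDom L Z₀c) Ac n) a (QkR F e hn (fineDom L Z₀c) Ac) (inclι (fineDom_mono hL hsub) p)
        (inclι (fineDom_mono hL hsub) q) = B4GaussRep36.deltaK (ham0 F e hn hL a m2 hsub Ac) a (QkR F e hn (fineDom L Zc) Ac) p q := by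
  unfold B4GaussRep36.deltaK
  rw [gk_eq_green, gk_ham0 hn hL hsub hℓ hLip he ha hm hc h17 hsmall]
  simp only [Matrix.sub_apply, Matrix.smul_apply, Matrix.one_apply, smul_eq_mul, (inclι_injective _).eq_iff]
  congr 2
  rw [Matrix.mul_apply, Matrix.mul_apply, sum_eq_sum_inclι (fine_sub hn hL hsub) _ fun P hP => by
    rw [Matrix.transpose_apply, QkR_incl_out F e hn hL hsub Ac q P hP, mul_zero]]
  refine Finset.sum_congr rfl fun r' _ => ?_
  rw [Matrix.transpose_apply, Matrix.transpose_apply, QkR_incl F e hn hL hsub Ac, Matrix.mul_apply, Matrix.mul_apply,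
    sum_eq_sum_inclι (fine_sub hn hL hsub) _ fun P hP => by rw [QkR_incl_out F e hn hL hsub Ac p P hP, zero_mul]]
  congr 1
  exact Finset.sum_congr rfl fun r _ => by rw [QkR_incl F e hn hL hsub Ac]; rfl

include hℓ hLip he ha hm hc h17 hsmall in
/-- **(5.3) FOR `[Δ^{(k)}(Ω₀,A) + a′L^{−2}P(A)]` RESTRICTED TO `Ω^{(k)}`** (r01's `hlow₀`): a lower bound (5.3) for the
operator of `Ω₀` on `Ω₀^{(k)}` descends to its restriction (test vectors extended by zero).
[cite: Balaban1983RegularityDecay, (5.3) p.593, (1.15) p.574] -/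
theorem form115_lower_ambient {γ s w : ℝ}
    (hlow₀ : ∀ φ : ↥(fineDom L Z₀c) × ι → ℝ, γ * (φ ⬝ᵥ φ) ≤ φ ⬝ᵥ ((B4GaussRep36.deltaK (hamR F e m2 (fineDom L Z₀c) Ac n) a
      (QkR F e hn (fineDom L Z₀c) Ac) + s • pOp w (nextAvg F (e / n) hL Z₀c n Ac)) *ᵥ φ))
    (v : ↥(fineDom L Zc) × ι → ℝ) :
    γ * (v ⬝ᵥ v) ≤ v ⬝ᵥ ((B4GaussRep36.deltaK (ham0 F e hn hL a m2 hsub Ac) a (QkR F e hn (fineDom L Zc) Ac)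
      + s • pOp w (nextAvg F (e / n) hL Zc n Ac)) *ᵥ v) := by
  have hK : ∀ p q : ↥(fineDom L Zc) × ι,
      (B4GaussRep36.deltaK (hamR F e m2 (fineDom L Z₀c) Ac n) a (QkR F e hn (fineDom L Z₀c) Ac)
        + s • pOp w (nextAvg F (e / n) hL Z₀c n Ac)) (inclι (fineDom_mono hL hsub) p) (inclι (fineDom_mono hL hsub) q)
      = (B4GaussRep36.deltaK (ham0 F e hn hL a m2 hsub Ac) a (QkR F e hn (fineDom L Zc) Ac)
        + s • pOp w (nextAvg F (e / n) hL Zc n Ac)) p q := fun p q => by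
    rw [Matrix.add_apply, Matrix.add_apply, Matrix.smul_apply, Matrix.smul_apply,
      deltaK_incl hn hL hsub hℓ hLip he ha hm hc h17 hsmall, pOp_incl F (e / n) hL hsub Ac]
  rw [← extV_dotProduct_extV (fineDom_mono hL hsub) v v, ← dot_extV_mulVec_extV (fineDom_mono hL hsub) _ _ hK v v]
  exact hlow₀ _

end Entries

end

end Literature.MathematicalPhysics.QuantumFieldTheory.Balaban1983to89.B4Ineq120RegularAmbient
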